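import Summits.ABC.ABC.Theorems.SoloBlindCycloRad
import HarnessLib

/-!
# Congruence abc implies abc — a kernel edge from the power-ends self-reduction

Solo seat `solo-ABC-blind` (ideation tier, summit-directed), session 6.

**Theorem** (`abc_iff_congruenceABC`).  For every `N ≥ 1`, `ABC` is equivalent to abc restricted to
abc triples with `N ∣ abc` (`CongruenceABC N`).  This is Oesterlé's remark for `N = 16` and
Ellenberg's theorem (Indag. Math. 11 (2000) 197–200) for general `N`; here it drops out of the
power-ends self-reduction `abc_iff_abcOnPowEnds` (`SoloBlindCycloRad`): abc restricted to triples
`(x^m, b, z^m)` is already equivalent to abc for every `m ≥ 1`, and with `m = N!` every such triple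
has `N ∣ x^m · b · z^m` — for a prime power `p^k ∣ N`, either `p ∣ xz` and then `p^k ∣ x^m z^m`
(`k ≤ p^k ≤ N ≤ N!`), or `p ∤ xz` and then `p^k ∣ z^m − x^m = b` by Euler (`φ(p^k) ≤ p^k ≤ N`, so
`φ(p^k) ∣ N!`) (`prime_pow_dvd_powEnds`, `dvd_powEnds`).

So restricting abc by a congruence buys nothing, exactly as restricting it to powerful triples
(`SoloBlindPythagorean`) buys nothing: both restrictions are images of equality cases of Mason's
theorem.

References: Oesterlé, Sém. Bourbaki 694 (1988) [Oesterle1988]; Ellenberg, *Congruence ABC implies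
ABC*, Indag. Math. N.S. 11 (2000) 197–200, arXiv:math/9909098 [Ellenberg2000]; Martin–Miao,
*abc triples*, Funct. Approx. 55 (2016), arXiv:1409.2974, §'Congruence abc' [MartinMiao2016].
-/

noncomputable section

open UniqueFactorizationMonoid

namespace Summit.ABC.ABC.Theorems

open Literature.NumberTheory.DiophantineGeometry

/-- `CongruenceABC N`: the abc inequality restricted to abc triples with `N ∣ a b c`
(Ellenberg's "congruence abc conjecture" for the modulus `N`). [topic NumberTheory/DiophantineGeometry]
[Ellenberg2000] -/
def CongruenceABC (N : ℕ) : Prop :=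
  ∀ ε : ℝ, 0 < ε → ∃ C : ℝ, 0 < C ∧ ∀ a b c : ℕ, IsABCTriple a b c → N ∣ a * b * c →
    (c : ℝ) < C * ((rad a b c : ℕ) : ℝ) ^ (1 + ε)

/-- For a prime power `p^k ∣ N` (`N ≥ 1`) and `x ≤ z`:  `p^k ∣ x^{N!} · (z^{N!} − x^{N!}) · z^{N!}`.
[folklore] -/
theorem prime_pow_dvd_powEnds {N p k x z : ℕ} (hp : p.Prime) (hpk : p ^ k ∣ N) (hN : 0 < N)
    (hxz : x ≤ z) :
    p ^ k ∣ x ^ N.factorial * (z ^ N.factorial - x ^ N.factorial) * z ^ N.factorial := by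
  rcases Nat.eq_zero_or_pos k with rfl | hk
  · simp
  have hpkN : p ^ k ≤ N := Nat.le_of_dvd hN hpk
  have hkle : k ≤ N.factorial :=
    ((Nat.lt_pow_self hp.one_lt).le.trans hpkN).trans (Nat.self_le_factorial N)
  by_cases hx : p ∣ x
  · exact dvd_mul_of_dvd_left (dvd_mul_of_dvd_left
      ((pow_dvd_pow_of_dvd hx k).trans (pow_dvd_pow x hkle)) _) _
  by_cases hz : p ∣ z
  · exact dvd_mul_of_dvd_right ((pow_dvd_pow_of_dvd hz k).trans (pow_dvd_pow z hkle)) _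
  -- `p ∤ x z`: Euler's theorem modulo `p^k`, with `φ(p^k) ∣ N!`
  have hφ : Nat.totient (p ^ k) ∣ N.factorial :=
    Nat.dvd_factorial (Nat.totient_pos.mpr (pow_pos hp.pos k)) ((Nat.totient_le _).trans hpkN)
  obtain ⟨q, hq⟩ := hφ
  have hxc : Nat.Coprime x (p ^ k) :=
    Nat.Coprime.pow_right k ((Nat.Prime.coprime_iff_not_dvd hp).mpr hx).symm
  have hzc : Nat.Coprime z (p ^ k) :=
    Nat.Coprime.pow_right k ((Nat.Prime.coprime_iff_not_dvd hp).mpr hz).symm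
  have h1 : x ^ N.factorial ≡ 1 [MOD p ^ k] := by
    rw [hq, pow_mul]
    simpa using (Nat.ModEq.pow_totient hxc).pow q
  have h2 : z ^ N.factorial ≡ 1 [MOD p ^ k] := by
    rw [hq, pow_mul]
    simpa using (Nat.ModEq.pow_totient hzc).pow q
  have h3 : x ^ N.factorial ≡ z ^ N.factorial [MOD p ^ k] := h1.trans h2.symm
  have h4 : p ^ k ∣ z ^ N.factorial - x ^ N.factorial :=
    (Nat.modEq_iff_dvd' (Nat.pow_le_pow_left hxz _)).mp h3
  exact dvd_mul_of_dvd_left (dvd_mul_of_dvd_right h4 _) _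

/-- `N ∣ x^{N!} · (z^{N!} − x^{N!}) · z^{N!}` for all `x ≤ z` (`N ≥ 1`). [folklore] -/
theorem dvd_powEnds {N x z : ℕ} (hN : 0 < N) (hxz : x ≤ z) :
    N ∣ x ^ N.factorial * (z ^ N.factorial - x ^ N.factorial) * z ^ N.factorial :=
  (Nat.dvd_iff_prime_pow_dvd_dvd _ _).mpr fun _ _ hp hpk => prime_pow_dvd_powEnds hp hpk hN hxz

/-- `CongruenceABC N → ABCOnPowEnds N!`. [folklore] -/
theorem abcOnPowEnds_of_congruenceABC {N : ℕ} (hN : 0 < N) (h : CongruenceABC N) :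
    ABCOnPowEnds N.factorial := by
  intro ε hε
  obtain ⟨C, hC, H⟩ := h ε hε
  refine ⟨C, hC, ?_⟩
  rintro a b c ht ⟨x, rfl⟩ ⟨z, rfl⟩
  have habc : x ^ N.factorial + b = z ^ N.factorial := ht.2.2.1
  have hb : b = z ^ N.factorial - x ^ N.factorial := by omega
  have hxz : x ≤ z := by
    by_contra hlt
    have : z ^ N.factorial < x ^ N.factorial :=
      Nat.pow_lt_pow_left (by omega) (Nat.factorial_pos N).ne'
    omega
  refine H _ _ _ ht ?_
  rw [hb]
  exact dvd_powEnds hN hxz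

/-- `ABC → CongruenceABC N` (restriction). [folklore] -/
theorem congruenceABC_of_abc (habc : ABC) (N : ℕ) : CongruenceABC N := by
  rw [ABC_iff] at habc
  intro ε hε
  obtain ⟨C, hC, H⟩ := habc ε hε
  exact ⟨C, hC, fun a b c h _ => H a b c h⟩

/-- **Congruence abc ⟺ abc** (Oesterlé `N = 16`; Ellenberg 2000 for all `N`): for every `N ≥ 1`,
`ABC ↔ CongruenceABC N`. [Ellenberg2000] -/
theorem abc_iff_congruenceABC {N : ℕ} (hN : 0 < N) : ABC ↔ CongruenceABC N :=
  ⟨fun h => congruenceABC_of_abc h N,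
    fun h => abc_of_abcOnPowEnds (Nat.factorial_pos N) (abcOnPowEnds_of_congruenceABC hN h)⟩

/-- The case singled out by Oesterlé: abc for triples with `16 ∣ abc` is abc. [Oesterle1988] -/
theorem abc_iff_congruenceABC_sixteen : ABC ↔ CongruenceABC 16 :=
  abc_iff_congruenceABC (by norm_num)

end Summit.ABC.ABC.Theorems

end
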